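import Mathlib
import Literature.RepresentationTheory.FiniteGroups.KLRGradedCellularBasis

/-!
# `SnSubsetDichotomy.NoThresholdSubsetTriple`, line `klr-graded-polynomial-method`:
# stub `stub_core_le_durfee` (the `2`-charge is at most the Durfee number)

For every partition `μ ⊢ n` with `2`-charge `ξ = c₀ − c₁` (`cᵢ = residueContent 2 μ i`, the
number of cells of `2`-residue `i`) and Durfee number `d = #{j < n : (j, j) ∈ μ}`:
`ξ(2ξ − 1) ≤ d(2d + 1)`.

Proof. `ξ = Σ_{x ∈ μ} (−1)^{row + col}` (a cell has `2`-residue `0` iff its row and column have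
the same parity). Partition the cells by their diagonal-hook index `m(x) = min(row, col)`; since
`μ` is a lower set, `m` takes values in `D = {j : (j, j) ∈ μ}`, `|D| = d`. The fibre of `j` is
the diagonal hook: the leg-with-corner `{(r, j) : j ≤ r < colLen j}` and the arm
`{(j, c) : j < c < rowLen j}`. Along it the signs alternate: the leg-with-corner sum is
`Σ_{t < colLen j − j} (−1)^t ∈ {0, 1}` and the arm sum is `−Σ_{t < rowLen j − j − 1} (−1)^t ∈ {−1, 0}`,
so every hook sum lies in `[−1, 1]` and `|ξ| ≤ d`. Finally
`d(2d + 1) − ξ(2ξ − 1) = (d + ξ)(2(d − ξ) + 1) ≥ 0`.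
-/

namespace Summit.MatrixMultiplication.MatrixMultiplication.Theorems

open Literature.RepresentationTheory.FiniteGroups (residueContent cellResidue)

/-- Twice an alternating sum of signs is `1 − (−1)^K`. [folklore] -/
private theorem two_mul_altSum (K : ℕ) :
    2 * ∑ k ∈ Finset.range K, (-1 : ℤ) ^ k = 1 - (-1) ^ K := by
  induction K with
  | zero => simp
  | succ K ih => rw [Finset.sum_range_succ, mul_add, ih]; ring

/-- An alternating sum of signs is `0` or `1`. [folklore] -/
private theorem altSum_mem (K : ℕ) :
    0 ≤ ∑ k ∈ Finset.range K, (-1 : ℤ) ^ k ∧ ∑ k ∈ Finset.range K, (-1 : ℤ) ^ k ≤ 1 := by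
  have h := two_mul_altSum K
  rcases neg_one_pow_eq_or ℤ K with h1 | h1 <;> rw [h1] at h <;> constructor <;> linarith

/-- The diagonal hook of corner `j` of a Young diagram: the cells `x` with `min x.1 x.2 = j` are
the leg-with-corner `{(r, j) : j ≤ r < colLen j}` together with the arm
`{(j, c) : j < c < rowLen j}`. [folklore] -/
private theorem hook_eq (Y : YoungDiagram) (j : ℕ) :
    Y.cells.filter (fun x : ℕ × ℕ => min x.1 x.2 = j) =
      (Finset.Ico j (Y.colLen j)).image (fun r => (r, j)) ∪
        (Finset.Ico (j + 1) (Y.rowLen j)).image (fun c => (j, c)) := by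
  ext ⟨a, b⟩
  simp only [Finset.mem_filter, YoungDiagram.mem_cells, Finset.mem_union, Finset.mem_image,
    Finset.mem_Ico]
  constructor
  · rintro ⟨hmem, hmin⟩
    rw [Nat.min_def] at hmin
    split_ifs at hmin with hle
    · rw [← hmin]
      rcases Nat.eq_or_lt_of_le hle with hab | hab
      · rw [← hab] at hmem ⊢
        exact Or.inl ⟨a, ⟨le_rfl, YoungDiagram.mem_iff_lt_colLen.1 hmem⟩, rfl⟩
      · exact Or.inr ⟨b, ⟨hab, YoungDiagram.mem_iff_lt_rowLen.1 hmem⟩, rfl⟩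
    · rw [← hmin]
      exact Or.inl ⟨a, ⟨by omega, YoungDiagram.mem_iff_lt_colLen.1 hmem⟩, rfl⟩
  · rintro (⟨r, ⟨hr1, hr2⟩, h⟩ | ⟨c, ⟨hc1, hc2⟩, h⟩)
    · simp only [Prod.mk.injEq] at h
      obtain ⟨h1, h2⟩ := h
      rw [← h1, ← h2]
      exact ⟨YoungDiagram.mem_iff_lt_colLen.2 hr2, min_eq_right hr1⟩
    · simp only [Prod.mk.injEq] at h
      obtain ⟨h1, h2⟩ := h
      rw [← h1, ← h2]
      exact ⟨YoungDiagram.mem_iff_lt_rowLen.2 hc2, min_eq_left (by omega)⟩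

/-- The leg-with-corner and the arm of a diagonal hook are disjoint. [folklore] -/
private theorem hook_disjoint (Y : YoungDiagram) (j : ℕ) :
    Disjoint ((Finset.Ico j (Y.colLen j)).image (fun r => (r, j)))
      ((Finset.Ico (j + 1) (Y.rowLen j)).image (fun c => (j, c))) := by
  rw [Finset.disjoint_left]
  intro x hx hx'
  simp only [Finset.mem_image, Finset.mem_Ico] at hx hx'
  obtain ⟨r, _, rfl⟩ := hx
  obtain ⟨c, ⟨hc, _⟩, h⟩ := hx'
  simp only [Prod.mk.injEq] at h
  omega

/-- The signed sum `Σ (−1)^{row + col}` over a diagonal hook lies in `[−1, 1]` (the signs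
alternate along the hook). [folklore] -/
private theorem abs_hookSum_le (Y : YoungDiagram) (j : ℕ) :
    |∑ x ∈ Y.cells.filter (fun x : ℕ × ℕ => min x.1 x.2 = j), (-1 : ℤ) ^ (x.1 + x.2)| ≤ 1 := by
  have hinj1 : Set.InjOn (fun r : ℕ => (r, j)) ↑(Finset.Ico j (Y.colLen j)) :=
    (Prod.mk_left_injective j).injOn
  have hinj2 : Set.InjOn (fun c : ℕ => (j, c)) ↑(Finset.Ico (j + 1) (Y.rowLen j)) :=
    (Prod.mk_right_injective j).injOn
  rw [hook_eq, Finset.sum_union (hook_disjoint Y j), Finset.sum_image hinj1,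
    Finset.sum_image hinj2, Finset.sum_Ico_eq_sum_range, Finset.sum_Ico_eq_sum_range]
  have e1 : ∀ k : ℕ, (-1 : ℤ) ^ (j + k + j) = (-1) ^ k := fun k => by
    rw [show j + k + j = 2 * j + k by ring, pow_add, pow_mul, neg_one_sq, one_pow, one_mul]
  have e2 : ∀ k : ℕ, (-1 : ℤ) ^ (j + (j + 1 + k)) = -(-1) ^ k := fun k => by
    rw [show j + (j + 1 + k) = 2 * j + k + 1 by ring, pow_succ, pow_add, pow_mul, neg_one_sq,
      one_pow, one_mul, mul_neg_one]
  simp only [e1, e2, Finset.sum_neg_distrib]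
  obtain ⟨h1, h2⟩ := altSum_mem (Y.colLen j - j)
  obtain ⟨h3, h4⟩ := altSum_mem (Y.rowLen j - (j + 1))
  rw [abs_le]
  constructor <;> linarith

/-- A diagonal cell `(j, j)` of the Young diagram of `μ ⊢ n` has `j < n`. [folklore] -/
private theorem lt_of_diag_mem {n : ℕ} (μ : Nat.Partition n) {j : ℕ}
    (h : (j, j) ∈ μ.youngDiagram) : j < n := by
  have h1 : j < μ.youngDiagram.rowLen j := YoungDiagram.mem_iff_lt_rowLen.1 h
  have h2 : μ.youngDiagram.rowLen j ≤ μ.youngDiagram.cells.card := by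
    rw [YoungDiagram.rowLen_eq_card]
    exact Finset.card_le_card fun c hc =>
      (YoungDiagram.mem_cells c).2 (YoungDiagram.mem_row_iff.1 hc).1
  rw [μ.card_cells_youngDiagram] at h2
  omega

/-- `|Σ_{x ∈ μ} (−1)^{row + col}| ≤ d(μ)`, the Durfee number: split the cells into diagonal
hooks (fibres of `x ↦ min x.1 x.2`, indexed by the diagonal cells) and bound each hook sum by
`1` in absolute value. [folklore] -/
private theorem abs_signSum_le_durfee {n : ℕ} (μ : Nat.Partition n) :
    |∑ x ∈ μ.youngDiagram.cells, (-1 : ℤ) ^ (x.1 + x.2)| ≤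
      (((Finset.range n).filter (fun j : ℕ => (j, j) ∈ μ.youngDiagram)).card : ℤ) := by
  have hmaps : ∀ x ∈ μ.youngDiagram.cells,
      min x.1 x.2 ∈ (Finset.range n).filter (fun j : ℕ => (j, j) ∈ μ.youngDiagram) := by
    rintro ⟨a, b⟩ hx
    have hdiag : (min a b, min a b) ∈ μ.youngDiagram :=
      μ.youngDiagram.up_left_mem (min_le_left a b) (min_le_right a b)
        ((YoungDiagram.mem_cells _).1 hx)
    exact Finset.mem_filter.2 ⟨Finset.mem_range.2 (lt_of_diag_mem μ hdiag), hdiag⟩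
  rw [← Finset.sum_fiberwise_of_maps_to hmaps]
  refine (Finset.abs_sum_le_sum_abs _ _).trans ?_
  refine (Finset.sum_le_sum fun j _ => abs_hookSum_le μ.youngDiagram j).trans ?_
  simp

/-- The `2`-charge is the signed cell sum: `c₀ − c₁ = Σ_{x ∈ μ} (−1)^{row + col}` (a cell has
`2`-residue `0` iff its row and column have the same parity). [folklore] -/
private theorem charge_eq_signSum {n : ℕ} (μ : Nat.Partition n) :
    (residueContent 2 μ 0 : ℤ) - (residueContent 2 μ 1 : ℤ) =
      ∑ x ∈ μ.youngDiagram.cells, (-1 : ℤ) ^ (x.1 + x.2) := by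
  unfold residueContent
  rw [Finset.natCast_card_filter, Finset.natCast_card_filter, ← Finset.sum_sub_distrib]
  refine Finset.sum_congr rfl fun x _ => ?_
  have h0 : cellResidue 2 x = 0 ↔ x.2 % 2 = x.1 % 2 := by
    unfold cellResidue
    rw [sub_eq_zero, ZMod.natCast_eq_natCast_iff']
  have h1 : cellResidue 2 x = 1 ↔ ¬ x.2 % 2 = x.1 % 2 := by
    rw [← h0]
    have hz : ∀ z : ZMod 2, z = 1 ↔ ¬ z = 0 := by decide
    exact hz _
  simp only [h0, h1]
  by_cases h : x.2 % 2 = x.1 % 2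
  · have he : Even (x.1 + x.2) := Nat.even_iff.2 (by omega)
    rw [he.neg_one_pow, if_pos h, if_neg (not_not.2 h)]
    norm_num
  · have ho : Odd (x.1 + x.2) := Nat.odd_iff.2 (by omega)
    rw [ho.neg_one_pow, if_neg h, if_pos h]
    norm_num

set_option linter.dupNamespace false in -- deliberate Summit.<S>.<P> duplicate
/-- **C′b — the `2`-charge is at most the Durfee number.** For every partition `μ ⊢ n` with
`2`-charge `ξ = c₀ − c₁` (`cᵢ = residueContent 2 μ i`) and Durfee number
`d = #{j < n : (j, j) ∈ μ}`: `ξ(2ξ − 1) ≤ d(2d + 1)`. Indeed `|ξ| ≤ d` (diagonal hooks have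
signed sums in `[−1, 1]`) and `d(2d + 1) − ξ(2ξ − 1) = (d + ξ)(2(d − ξ) + 1) ≥ 0`. -/
theorem stub_core_le_durfee : ∀ (n : ℕ) (μ : Nat.Partition n), ((residueContent 2 μ 0 : ℤ) - (residueContent 2 μ 1 : ℤ)) * (2 * ((residueContent 2 μ 0 : ℤ) - (residueContent 2 μ 1 : ℤ)) - 1) ≤ (((Finset.range n).filter (fun j : ℕ => (j, j) ∈ μ.youngDiagram)).card : ℤ) * (2 * (((Finset.range n).filter (fun j : ℕ => (j, j) ∈ μ.youngDiagram)).card : ℤ) + 1) := by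
  intro n μ
  have h := abs_signSum_le_durfee μ
  rw [← charge_eq_signSum μ, abs_le] at h
  obtain ⟨h1, h2⟩ := h
  nlinarith [mul_nonneg (by linarith : (0 : ℤ) ≤
      (((Finset.range n).filter (fun j : ℕ => (j, j) ∈ μ.youngDiagram)).card : ℤ) +
        ((residueContent 2 μ 0 : ℤ) - (residueContent 2 μ 1 : ℤ)))
    (by linarith : (0 : ℤ) ≤
      (((Finset.range n).filter (fun j : ℕ => (j, j) ∈ μ.youngDiagram)).card : ℤ) -
        ((residueContent 2 μ 0 : ℤ) - (residueContent 2 μ 1 : ℤ)))]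

end Summit.MatrixMultiplication.MatrixMultiplication.Theorems
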